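import Literature.Probability.RandomPlanarGeometry.HexSAWPolygonStepTwoMain
import HarnessLib

/-!
# The step `2` for honeycomb polygon numbers beyond the main classes: the ROOF move `Y⋆`
# (`#{X ∪ Y⋆} ≤ q_{N+2}(ℍ)`; the residue of `q_N(ℍ) ≤ q_{N+2}(ℍ)` is the single class «the top-right cell is an up-right leaf»)

Topic `Literature/Probability/RandomPlanarGeometry` (lane «pcv-sawmu», a-p4 g19; sequel of `HexSAWPolygonStepTwoMain.lean` —
`spliceAdd` / `SpliceAddOK` / `spliceAdd_mem_canonEnd` / `spliceAddOK_of_tables` (the `K`-general window surgery on canonically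
rooted honeycomb polygons `canonEnd n`, `#canonEnd n = q_{n+1}(ℍ)`), the case-X surgery `offX` with `topAt_spliceX`,
`spliceX_decode`, `stepTwo_data_X`, the top-corner lemmas `caseY_step1_fwd/bwd`, `caseY_step2_fwd/bwd`, `caseY_free`, and of
`HexSAWPolygonStepSix.lean` — `exists_top_corner`, `top_corner_pred/succ`, `tpath`, `rd`, `TopSix`, `topAt_unique`, `ne_of_high`).

Madras–Slade prove `q_N ≤ q_{N+2}` on `ℤ^d` by a unit-square surgery at the lexicographically largest vertex [MadrasSlade1993, §3.2,
Theorem 3.2.3, (3.2.3) p. 64, proof p. 65]; on the honeycomb lattice the statement fails at `N = 6, 10` (`HexSAWPolygonCensus`) and is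
open for `N ≥ 12`.  `HexSAWPolygonStepTwoMain` injects the classes X (`(xm−3,H) ∈ ω`) and Y1a (below the top corner `(xm,H)` the walk
steps down, right, down) into `canonEnd (n+2)`.  THIS FILE replaces Y1a by the **roof move `Y⋆`**, which serves EVERY polygon whose walk
steps RIGHT below the top corner, however long it then runs along the row `H−1`:

* if, after `(xm,H) → (xm,H−1) → (xm+1,H−1)`, the walk runs right along the row `H−1` up to `(xm+2k−1, H−1)` and then steps DOWN
  (`k ≥ 1`; `k = 1` is Y1a, `k ≥ 2` is the former residue class Y1b), replace that path of `2k` bonds by the roof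
  `(xm,H) → (xm+1,H) → … → (xm+2k,H) → (xm+2k,H−1) → (xm+2k−1,H−1)` of `2k+2` bonds (tables `offYs k`, `wYs`; admissibility
  `spliceOK_Ys`, freshness of `(xm+2k,H−1)` by `caseY_free` at the shifted corner abscissa `xm+2k−2`);
* the run always terminates this way (`exists_roof_run_fwd/bwd`: at the even offsets of the row `H−1` the vertical bond goes UP into
  the empty part of the top row, so the walk is forced to continue right; at the odd offsets it goes right or down);
* decoding: the image's top corner is `(xm+2k, H)` (`topAt_spliceYs`); the orientation is the site after the corner time; `k` is the
  length of the top-row run ending at the corner, which is exactly `2k+3` sites when the source is NOT of class X — so the datum carries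
  `(xm−3,H) ∉ ω` (`spliceYs_decode`); roof images and case-X images differ by the turn below the corner (`spliceX_ne_spliceYs`).

★ **`card_filter_isStepTwoRoof_le : 5 ≤ n → #{ω ∈ canonEnd n | IsStepTwoRoof n ω} ≤ #canonEnd (n+2)`**, where `IsStepTwoRoof`
= class X ∪ class Y⋆; and the dichotomy `isStepTwoRoof_or_isTopLeaf`: the complement is the single class `IsTopLeaf` — `(xm−3,H) ∉ ω`
and below the corner the walk steps LEFT, i.e. the top-right hexagon of the polygon hangs on its lower-left neighbour only (an «up-right
leaf» of the cell tree).  Complement form: `#canonEnd n − #{IsTopLeaf} ≤ #canonEnd (n+2)`.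

NOT claimed: `q_N(ℍ) ≤ q_{N+2}(ℍ)`.  Numerically the leaf class is 3, 2, 13, 20, 76, 163, 533, 1332, 4141 of the 12, 18, 65, 138, 432,
1074, 3231, 8718, 25999 polygons for `N = 14, …, 30` (≈ 16 %; lane scripts `HOME/pub-sawmu-a-p4/g19/two/`), against ≈ 30 % for the
residue of `HexSAWPolygonStepTwoMain`; with the mirrored move at the bottom corner the joint residue is ≈ 2.5 %, and with the twelve
symmetric corners ≈ 0.3 % (door note `HOME/pub-sawmu-a-p4/g19/two/DOOR-STEP-TWO-addendum-g19.md`).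
Label (lane): LANE LEMMA / infrastructure for an open combinatorial item; no literature claim beyond the transplanted `ℤ^d` method.
-/

noncomputable section

open Finset Function Literature.Probability.LatticeModels Literature.Probability.Percolation SimpleGraph

namespace Literature.Probability.RandomPlanarGeometry.SAW

namespace HexBW

namespace PolygonConcat

variable {n : ℕ} {ω : ℕ → Site 2}

/-- Two sites of `ℤ²` are equal iff both coordinates agree. [folklore; lane plumbing] [cite: MadrasSlade1993, §1.1] -/
private theorem ys_site_eq_iff {x y : Site 2} : x = y ↔ x 0 = y 0 ∧ x 1 = y 1 := by
  constructor
  · rintro rfl; exact ⟨rfl, rfl⟩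
  · rintro ⟨h0, h1⟩; funext i; fin_cases i <;> assumption

/-- `pt a b` is lexicographically `≥ 0` when `a > 0`, or `a = 0 ≤ b`. [cite: MadrasSlade1993, §3.2 (proof of Theorem 3.2.3: `Q[N]`)] -/
private theorem ys_lexNonneg_pt {a b : ℤ} (h : 0 < a ∨ (a = 0 ∧ 0 ≤ b)) : LexNonneg (pt a b) := by
  unfold LexNonneg; simpa using h

section Roof

variable {xm H : ℤ} {fwd : Bool} {j k : ℕ}

/-- Window table of the roof move `Y⋆_k` (offsets from the top corner): `(0,0)`, then the run `(s−1, −1)`, `1 ≤ s ≤ 2k`, along the row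
`H−1` — the corner, the step down, and `2k−1` steps right. [cite: MadrasSlade1993, §3.2 (proof of Theorem 3.2.3: local surgery)] -/
def wYs (s : ℕ) : ℤ × ℤ := if s = 0 then (0, 0) else ((s : ℤ) - 1, -1)

/-- Replacement table of the roof move `Y⋆_k`: the roof `(s, 0)`, `0 ≤ s ≤ 2k`, over the run, then down to `(2k, −1)` and left to
`(2k−1, −1)` — `2k+2` bonds replacing the `2k` bonds of `wYs`. [cite: MadrasSlade1993, §3.2 (proof of Theorem 3.2.3: local surgery)] -/
def offYs (k : ℕ) (s : ℕ) : ℤ × ℤ :=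
  if s ≤ 2 * k then ((s : ℤ), 0) else if s = 2 * k + 1 then (2 * (k : ℤ), -1) else (2 * (k : ℤ) - 1, -1)

/-- The roof table is a brick-wall path (given the top-corner parity `xm + H` odd: the bond `(xm+2k,H) – (xm+2k,H−1)` is vertical at an
even lower site). [cite: EntingJensen2009, §7.4.2, Fig. 7.10 (brickwork form of the honeycomb lattice)] -/
theorem offYs_adj (hpar : (xm + H) % 2 = 1) {s : ℕ} (hs : s < 2 * k + 2) :
    brickWallGraph.Adj (pt (xm + (offYs k s).1) (H + (offYs k s).2)) (pt (xm + (offYs k (s + 1)).1) (H + (offYs k (s + 1)).2)) := by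
  unfold offYs
  rcases Nat.lt_or_ge (s + 1) (2 * k + 1) with h1 | h1
  · rw [if_pos (by omega), if_pos (by omega)]; push_cast; exact adj_pt_iff.2 (by omega)
  rcases Nat.lt_or_ge s (2 * k + 1) with h2 | h2
  · have hs' : s = 2 * k := by omega
    subst hs'
    rw [if_pos le_rfl, if_neg (by omega), if_pos rfl]; push_cast; exact adj_pt_iff.2 (by omega)
  · have hs' : s = 2 * k + 1 := by omega
    subst hs'
    rw [if_neg (by omega), if_pos rfl, if_neg (by omega), if_neg (by omega)]; exact adj_pt_iff.2 (by omega)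

/-- The roof table is injective on `[0, 2k+2]`. [cite: MadrasSlade1993, §3.2] -/
theorem offYs_inj {s s' : ℕ} (hs : s ≤ 2 * k + 2) (hs' : s' ≤ 2 * k + 2)
    (h : pt (xm + (offYs k s).1) (H + (offYs k s).2) = pt (xm + (offYs k s').1) (H + (offYs k s').2)) : s = s' := by
  obtain ⟨h1, h2⟩ := pt_inj.1 h
  unfold offYs at h1 h2
  split_ifs at h1 h2 <;> push_cast at h1 h2 <;> omega

/-- The window table read at offset `0` is the corner and at offset `s ≥ 1` the run site `(xm+s−1, H−1)`. [cite: MadrasSlade1993, §3.2] -/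
theorem wYs_pos {s : ℕ} (hs : 1 ≤ s) : wYs s = ((s : ℤ) - 1, -1) := if_neg (by omega)

/-- **The roof surgery is admissible**: for `xm ≥ 1`, the window `(xm,H)(xm,H−1)(xm+1,H−1)…(xm+2k−1,H−1)` on `ω` (`k ≥ 1`) and
`(xm+2k, H−1)` NOT a site of `ω`, the roof `offYs k` satisfies `SpliceAddOK n 2 (2k)`: its interior sites are on the top row right of
the corner (hence off `ω`) or the one site `(xm+2k, H−1)`. [cite: MadrasSlade1993, §3.2 (proof of Theorem 3.2.3: local surgery)] -/
theorem spliceOK_Ys (hpar : (xm + H) % 2 = 1) (hx : 1 ≤ xm) (hk : 1 ≤ k)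
    (hmaxH : ∀ i, i ≤ n → ω i 1 ≤ H) (hmaxX : ∀ i, i ≤ n → ω i 1 = H → ω i 0 ≤ xm)
    (hE : ∀ i, i ≤ n → ω i ≠ pt (xm + 2 * k) (H - 1))
    (hw : ∀ s, s ≤ 2 * k → ω (j + s) = tpath wYs (2 * k) xm H fwd s) (hwnd : j + 2 * k ≤ n) :
    SpliceAddOK n 2 (2 * k) ω j (tpath (offYs k) (2 * k + 2) xm H fwd) := by
  refine spliceAddOK_of_tables (L := 2 * k) (K := 2) (w := wYs) (by omega) ?_ ?_ (fun s hs => offYs_adj hpar hs)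
    (fun s s' hs hs' h => offYs_inj hs hs' h) (fun u hu0 hu1 i hi _ => ?_) (fun u hu => ?_) hw hwnd
  · simp [offYs, wYs]
  · rw [wYs_pos (by omega)]; unfold offYs; rw [if_neg (by omega), if_neg (by omega)]; push_cast; ring_nf
  · unfold offYs
    by_cases h1 : u ≤ 2 * k
    · rw [if_pos h1]; push_cast; exact ne_of_high hmaxH hmaxX (by omega) hi
    · rw [if_neg h1, if_pos (by omega), show H + -1 = H - 1 by ring]
      exact fun h => hE i hi h.symm
  · unfold offYs; split_ifs <;> push_cast <;> exact ys_lexNonneg_pt (by omega)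

/-- **The roof image is a canonical `(n+3)`-gon.** [cite: MadrasSlade1993, §3.2 (proof of Theorem 3.2.3)] -/
theorem spliceYs_mem_canonEnd (hω : ω ∈ canonEnd n) (hpar : (xm + H) % 2 = 1) (hx : 1 ≤ xm) (hk : 1 ≤ k)
    (hmaxH : ∀ i, i ≤ n → ω i 1 ≤ H) (hmaxX : ∀ i, i ≤ n → ω i 1 = H → ω i 0 ≤ xm)
    (hE : ∀ i, i ≤ n → ω i ≠ pt (xm + 2 * k) (H - 1))
    (hw : ∀ s, s ≤ 2 * k → ω (j + s) = tpath wYs (2 * k) xm H fwd s) (hwnd : j + 2 * k ≤ n) :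
    spliceAdd 2 (2 * k) ω (tpath (offYs k) (2 * k + 2) xm H fwd) j ∈ canonEnd (n + 2) :=
  spliceAdd_mem_canonEnd hω (spliceOK_Ys hpar hx hk hmaxH hmaxX hE hw hwnd)

/-- **Freshness of `(xm+2k, H−1)`**: if the last run site `(xm+2k−1, H−1) = ω a` has walk-neighbours `(xm+2k−2, H−1)` and
`(xm+2k−1, H−2)` (the walk arrives along the run and steps down), then `(xm+2k, H−1)` is not a site of `ω` — `caseY_free` at the shifted
abscissa `xm + 2k − 2`. [cite: EntingJensen2009, §7.4.2, Fig. 7.10 (brickwork form of the honeycomb lattice)] -/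
theorem caseYs_free (hω : ω ∈ endAt n (Pi.single 0 1 : Site 2)) (hpar : (xm + H) % 2 = 1) (hx : 1 ≤ xm) (hk : 1 ≤ k)
    (hmaxH : ∀ i, i ≤ n → ω i 1 ≤ H) (hmaxX : ∀ i, i ≤ n → ω i 1 = H → ω i 0 ≤ xm)
    {a : ℕ} (ha1 : 1 ≤ a) (han : a + 1 ≤ n) (ha : ω a = pt (xm + 2 * k - 1) (H - 1))
    (hnb : (ω (a - 1) = pt (xm + 2 * k - 2) (H - 1) ∧ ω (a + 1) = pt (xm + 2 * k - 1) (H - 2)) ∨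
      (ω (a + 1) = pt (xm + 2 * k - 2) (H - 1) ∧ ω (a - 1) = pt (xm + 2 * k - 1) (H - 2))) :
    ∀ t, t ≤ n → ω t ≠ pt (xm + 2 * k) (H - 1) := by
  have hmaxX' : ∀ i, i ≤ n → ω i 1 = H → ω i 0 ≤ xm + 2 * k - 2 := fun i hi hiH => by
    have := hmaxX i hi hiH; omega
  have h := caseY_free (xm := xm + 2 * k - 2) (H := H) hω (by omega) (by omega) hmaxH hmaxX' ha1 han
    (by rw [ha]; congr 1; ring) ?_
  · intro t ht; rw [show xm + 2 * k = xm + 2 * k - 2 + 2 by ring]; exact h t ht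
  · rcases hnb with ⟨h1, h2⟩ | ⟨h1, h2⟩
    · left; refine ⟨by rw [h1], by rw [h2]; congr 1; ring⟩
    · right; refine ⟨by rw [h1], by rw [h2]; congr 1; ring⟩


/-! ### The run below the top corner always ends with a step down -/

/-- **One step along the run, forward.** On the row `H−1`, right of the corner abscissa, the walk arriving from the left at
`(xm+s−1, H−1)` (time `i₀+s`, `s ≥ 2`) continues RIGHT to `(xm+s, H−1)`, or — only when `s` is even, i.e. at the sites whose vertical
bond goes down — DOWN to `(xm+s−1, H−2)`; at odd `s` the vertical bond goes UP to `(xm+s−1, H)`, right of the top corner, which is not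
on `ω`. [cite: EntingJensen2009, §7.4.2, Fig. 7.10 (brickwork form of the honeycomb lattice)] -/
theorem roof_run_step_fwd {xm H : ℤ} {i₀ s : ℕ} (hω : ω ∈ endAt n (Pi.single 0 1 : Site 2)) (hpar : (xm + H) % 2 = 1)
    (hx : 2 ≤ xm) (hmaxX : ∀ i, i ≤ n → ω i 1 = H → ω i 0 ≤ xm) (hs : 2 ≤ s) (hsn : i₀ + s ≤ n)
    (hprev : ω (i₀ + (s - 1)) = pt (xm + (s - 1 : ℕ) - 1) (H - 1)) (hcur : ω (i₀ + s) = pt (xm + s - 1) (H - 1)) :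
    i₀ + s + 1 ≤ n ∧ (ω (i₀ + s + 1) = pt (xm + s) (H - 1) ∨ (s % 2 = 0 ∧ ω (i₀ + s + 1) = pt (xm + s - 1) (H - 2))) := by
  obtain ⟨⟨h0, -, hbw, hinj⟩, hn'⟩ := mem_endAt_iff.1 hω
  have hne : i₀ + s ≠ n := by
    intro h; rw [h, hn'] at hcur; have := congrFun hcur 0; simp at this; omega
  refine ⟨by omega, ?_⟩
  have hadj : brickWallGraph.Adj (ω (i₀ + s)) (ω (i₀ + s + 1)) := hbw (i₀ + s) (by omega)
  rw [hcur] at hadj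
  have hback : ω (i₀ + s + 1) ≠ ω (i₀ + (s - 1)) := by
    intro h
    have := hinj (show i₀ + s + 1 ∈ {i | i ≤ n} by simp; omega) (show i₀ + (s - 1) ∈ {i | i ≤ n} by simp; omega) h; omega
  have hX := hmaxX (i₀ + s + 1) (by omega)
  rcases adj_cases hadj with ⟨hz0, hz1⟩ | ⟨hz0, hz1⟩ | hz0
  · left; rw [ys_site_eq_iff]; simp only [pt_apply_zero, pt_apply_one] at hz0 hz1 ⊢; omega
  · exfalso; apply hback; rw [hprev, ys_site_eq_iff]; simp only [pt_apply_zero, pt_apply_one] at hz0 hz1 ⊢; omega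
  · rcases vertical_cases hadj hz0 with ⟨hy, hp⟩ | ⟨hy, hp⟩
    · -- up: `(xm+s−1, H)` is right of the top corner
      exfalso; simp only [pt_apply_zero, pt_apply_one] at hz0 hy; have := hX (by omega); omega
    · right; simp only [pt_apply_zero, pt_apply_one] at hz0 hy hp
      refine ⟨by omega, ?_⟩
      rw [ys_site_eq_iff]; simp only [pt_apply_zero, pt_apply_one]; omega

/-- **One step along the run, backward** (times decreasing): with `ω (i₀−(s−1)) = (xm+s−2,H−1)`, `ω (i₀−s) = (xm+s−1,H−1)`, `s ≥ 2`,
the site `ω (i₀−(s+1))` is `(xm+s,H−1)`, or `(xm+s−1,H−2)` when `s` is even (and `s+1 ≤ i₀`).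
[cite: EntingJensen2009, §7.4.2, Fig. 7.10 (brickwork form of the honeycomb lattice)] -/
theorem roof_run_step_bwd {xm H : ℤ} {i₀ s : ℕ} (hω : ω ∈ endAt n (Pi.single 0 1 : Site 2)) (hpar : (xm + H) % 2 = 1)
    (hx : 2 ≤ xm) (hmaxX : ∀ i, i ≤ n → ω i 1 = H → ω i 0 ≤ xm) (hs : 2 ≤ s) (hsi : s ≤ i₀) (hi₀n : i₀ ≤ n)
    (hprev : ω (i₀ - (s - 1)) = pt (xm + (s - 1 : ℕ) - 1) (H - 1)) (hcur : ω (i₀ - s) = pt (xm + s - 1) (H - 1)) :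
    s + 1 ≤ i₀ ∧ (ω (i₀ - (s + 1)) = pt (xm + s) (H - 1) ∨ (s % 2 = 0 ∧ ω (i₀ - (s + 1)) = pt (xm + s - 1) (H - 2))) := by
  obtain ⟨⟨h0, -, hbw, hinj⟩, hn'⟩ := mem_endAt_iff.1 hω
  have hne : i₀ - s ≠ 0 := by
    intro h; rw [h, h0] at hcur; have := congrFun hcur 0; simp at this; omega
  refine ⟨by omega, ?_⟩
  have hadj : brickWallGraph.Adj (ω (i₀ - s)) (ω (i₀ - (s + 1))) := by
    have := hbw (i₀ - (s + 1)) (by omega); rw [show i₀ - (s + 1) + 1 = i₀ - s by omega] at this; exact this.symm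
  rw [hcur] at hadj
  have hback : ω (i₀ - (s + 1)) ≠ ω (i₀ - (s - 1)) := by
    intro h
    have := hinj (show i₀ - (s + 1) ∈ {i | i ≤ n} by simp; omega) (show i₀ - (s - 1) ∈ {i | i ≤ n} by simp; omega) h; omega
  have hX := hmaxX (i₀ - (s + 1)) (by omega)
  rcases adj_cases hadj with ⟨hz0, hz1⟩ | ⟨hz0, hz1⟩ | hz0
  · left; rw [ys_site_eq_iff]; simp only [pt_apply_zero, pt_apply_one] at hz0 hz1 ⊢; omega
  · exfalso; apply hback; rw [hprev, ys_site_eq_iff]; simp only [pt_apply_zero, pt_apply_one] at hz0 hz1 ⊢; omega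
  · rcases vertical_cases hadj hz0 with ⟨hy, hp⟩ | ⟨hy, hp⟩
    · exfalso; simp only [pt_apply_zero, pt_apply_one] at hz0 hy; have := hX (by omega); omega
    · right; simp only [pt_apply_zero, pt_apply_one] at hz0 hy hp
      refine ⟨by omega, ?_⟩
      rw [ys_site_eq_iff]; simp only [pt_apply_zero, pt_apply_one]; omega

/-- **The run ends with a step down, forward**: if below the top corner the walk steps down then right
(`ω (i₀+1) = (xm,H−1)`, `ω (i₀+2) = (xm+1,H−1)`), then for some `k ≥ 1` it runs `ω (i₀+s) = (xm+s−1,H−1)` for `1 ≤ s ≤ 2k` and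
steps down next: `ω (i₀+2k+1) = (xm+2k−1,H−2)` (with `i₀+2k+1 ≤ n`). [cite: MadrasSlade1993, §3.2 (proof of Theorem 3.2.3: the local
structure at the lexicographically largest point)] -/
theorem exists_roof_run_fwd {xm H : ℤ} {i₀ : ℕ} (hω : ω ∈ endAt n (Pi.single 0 1 : Site 2)) (hpar : (xm + H) % 2 = 1)
    (hx : 2 ≤ xm) (hmaxX : ∀ i, i ≤ n → ω i 1 = H → ω i 0 ≤ xm) (hi₀n : i₀ + 2 ≤ n)
    (h1 : ω (i₀ + 1) = pt xm (H - 1)) (h2 : ω (i₀ + 2) = pt (xm + 1) (H - 1)) :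
    ∃ k, 1 ≤ k ∧ i₀ + 2 * k + 1 ≤ n ∧ (∀ s, 1 ≤ s → s ≤ 2 * k → ω (i₀ + s) = pt (xm + s - 1) (H - 1)) ∧
      ω (i₀ + 2 * k + 1) = pt (xm + 2 * k - 1) (H - 2) := by
  -- induction on the distance to the end of the walk
  suffices aux : ∀ d t, 1 ≤ t → i₀ + 2 * t ≤ n → n - (i₀ + 2 * t) ≤ d →
      (∀ s, 1 ≤ s → s ≤ 2 * t → ω (i₀ + s) = pt (xm + s - 1) (H - 1)) →
      ∃ k, 1 ≤ k ∧ i₀ + 2 * k + 1 ≤ n ∧ (∀ s, 1 ≤ s → s ≤ 2 * k → ω (i₀ + s) = pt (xm + s - 1) (H - 1)) ∧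
        ω (i₀ + 2 * k + 1) = pt (xm + 2 * k - 1) (H - 2) by
    refine aux n 1 le_rfl (by omega) (by omega) fun s hs1 hs2 => ?_
    interval_cases s
    · rw [h1]; congr 1; ring
    · rw [h2]; congr 1; ring
  intro d
  induction d with
  | zero =>
    intro t ht htn hd hrun
    -- the run cannot occupy the last time `n` (`ω n = e₀` has abscissa `1 < xm`)
    obtain ⟨⟨h0, -, hbw, hinj⟩, hn'⟩ := mem_endAt_iff.1 hω
    exfalso
    have h := hrun (2 * t) (by omega) le_rfl
    rw [show i₀ + 2 * t = n by omega, hn'] at h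
    have := congrFun h 0; simp at this; omega
  | succ d ih =>
    intro t ht htn hd hrun
    have hprev : ω (i₀ + (2 * t - 1)) = pt (xm + (2 * t - 1 : ℕ) - 1) (H - 1) := hrun (2 * t - 1) (by omega) (by omega)
    have hcur : ω (i₀ + 2 * t) = pt (xm + (2 * t : ℕ) - 1) (H - 1) := hrun (2 * t) (by omega) le_rfl
    obtain ⟨hn1, hstep⟩ := roof_run_step_fwd hω hpar hx hmaxX (s := 2 * t) (by omega) htn hprev hcur
    rcases hstep with hR | ⟨-, hD⟩
    · -- right, then forced right again
      have hprev' : ω (i₀ + (2 * t + 1 - 1)) = pt (xm + (2 * t + 1 - 1 : ℕ) - 1) (H - 1) := by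
        rw [show 2 * t + 1 - 1 = 2 * t by omega, hcur]
      have hcur' : ω (i₀ + (2 * t + 1)) = pt (xm + (2 * t + 1 : ℕ) - 1) (H - 1) := by
        rw [← add_assoc, hR]; congr 1; push_cast; ring
      obtain ⟨hn2, hstep2⟩ := roof_run_step_fwd hω hpar hx hmaxX (s := 2 * t + 1) (by omega) hn1 hprev' hcur'
      rcases hstep2 with hRR | ⟨hodd, -⟩
      · refine ih (t + 1) (by omega) (by omega) (by omega) fun s hs1 hs2 => ?_
        rcases Nat.lt_or_ge s (2 * t + 1) with h3 | h3
        · exact hrun s hs1 (by omega)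
        rcases Nat.lt_or_ge s (2 * t + 2) with h4 | h4
        · obtain rfl : s = 2 * t + 1 := by omega
          exact hcur'
        · obtain rfl : s = 2 * t + 2 := by omega
          rw [show i₀ + (2 * t + 2) = i₀ + (2 * t + 1) + 1 by omega, hRR]; congr 1; push_cast; ring
      · omega
    · exact ⟨t, ht, hn1, hrun, by exact_mod_cast hD⟩

/-- **The run ends with a step down, backward** (`ω (i₀−1) = (xm,H−1)`, `ω (i₀−2) = (xm+1,H−1)`): for some `k ≥ 1`,
`ω (i₀−s) = (xm+s−1,H−1)` for `1 ≤ s ≤ 2k` and `ω (i₀−(2k+1)) = (xm+2k−1,H−2)` (with `2k+1 ≤ i₀`).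
[cite: MadrasSlade1993, §3.2 (proof of Theorem 3.2.3: the local structure at the lexicographically largest point)] -/
theorem exists_roof_run_bwd {xm H : ℤ} {i₀ : ℕ} (hω : ω ∈ endAt n (Pi.single 0 1 : Site 2)) (hpar : (xm + H) % 2 = 1)
    (hx : 2 ≤ xm) (hmaxX : ∀ i, i ≤ n → ω i 1 = H → ω i 0 ≤ xm) (hi₀ : 2 ≤ i₀) (hi₀n : i₀ ≤ n)
    (h1 : ω (i₀ - 1) = pt xm (H - 1)) (h2 : ω (i₀ - 2) = pt (xm + 1) (H - 1)) :
    ∃ k, 1 ≤ k ∧ 2 * k + 1 ≤ i₀ ∧ (∀ s, 1 ≤ s → s ≤ 2 * k → ω (i₀ - s) = pt (xm + s - 1) (H - 1)) ∧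
      ω (i₀ - (2 * k + 1)) = pt (xm + 2 * k - 1) (H - 2) := by
  suffices aux : ∀ d t, 1 ≤ t → 2 * t ≤ i₀ → i₀ - 2 * t ≤ d →
      (∀ s, 1 ≤ s → s ≤ 2 * t → ω (i₀ - s) = pt (xm + s - 1) (H - 1)) →
      ∃ k, 1 ≤ k ∧ 2 * k + 1 ≤ i₀ ∧ (∀ s, 1 ≤ s → s ≤ 2 * k → ω (i₀ - s) = pt (xm + s - 1) (H - 1)) ∧
        ω (i₀ - (2 * k + 1)) = pt (xm + 2 * k - 1) (H - 2) by
    refine aux i₀ 1 le_rfl (by omega) (by omega) fun s hs1 hs2 => ?_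
    interval_cases s
    · rw [h1]; congr 1; ring
    · rw [h2]; congr 1; ring
  intro d
  induction d with
  | zero =>
    intro t ht hti hd hrun
    obtain ⟨⟨h0, -, hbw, hinj⟩, hn'⟩ := mem_endAt_iff.1 hω
    exfalso
    have h := hrun (2 * t) (by omega) le_rfl
    rw [show i₀ - 2 * t = 0 by omega, h0] at h
    have := congrFun h 0; simp at this; omega
  | succ d ih =>
    intro t ht hti hd hrun
    have hprev : ω (i₀ - (2 * t - 1)) = pt (xm + (2 * t - 1 : ℕ) - 1) (H - 1) := hrun (2 * t - 1) (by omega) (by omega)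
    have hcur : ω (i₀ - 2 * t) = pt (xm + (2 * t : ℕ) - 1) (H - 1) := hrun (2 * t) (by omega) le_rfl
    obtain ⟨hn1, hstep⟩ := roof_run_step_bwd hω hpar hx hmaxX (s := 2 * t) (by omega) hti hi₀n hprev hcur
    rcases hstep with hR | ⟨-, hD⟩
    · have hprev' : ω (i₀ - (2 * t + 1 - 1)) = pt (xm + (2 * t + 1 - 1 : ℕ) - 1) (H - 1) := by
        rw [show 2 * t + 1 - 1 = 2 * t by omega, hcur]
      have hcur' : ω (i₀ - (2 * t + 1)) = pt (xm + (2 * t + 1 : ℕ) - 1) (H - 1) := by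
        rw [hR]; congr 1; push_cast; ring
      obtain ⟨hn2, hstep2⟩ := roof_run_step_bwd hω hpar hx hmaxX (s := 2 * t + 1) (by omega) hn1 hi₀n hprev' hcur'
      rcases hstep2 with hRR | ⟨hodd, -⟩
      · refine ih (t + 1) (by omega) (by omega) (by omega) fun s hs1 hs2 => ?_
        rcases Nat.lt_or_ge s (2 * t + 1) with h3 | h3
        · exact hrun s hs1 (by omega)
        rcases Nat.lt_or_ge s (2 * t + 2) with h4 | h4
        · obtain rfl : s = 2 * t + 1 := by omega
          exact hcur'
        · obtain rfl : s = 2 * t + 2 := by omega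
          rw [show 2 * t + 2 = 2 * t + 1 + 1 by omega, hRR]; congr 1; push_cast; ring
      · omega
    · exact ⟨t, ht, hn1, hrun, by exact_mod_cast hD⟩


/-! ### Surgery data for the roof move -/

/-- **Roof datum, forward**: from the run of length `2k` below the corner `ω i₀ = (xm,H)` ending with a step down, the roof surgery with
window at `j = i₀` is admissible, and the window reads the table `wYs`. [cite: MadrasSlade1993, §3.2 (proof of Theorem 3.2.3)] -/
theorem stepTwo_data_Ys_fwd (hω : ω ∈ canonEnd n) {i₀ : ℕ} (hx : 1 ≤ xm) (hk : 1 ≤ k) (hkn : i₀ + 2 * k + 1 ≤ n)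
    (hmaxH : ∀ i, i ≤ n → ω i 1 ≤ H) (hmaxX : ∀ i, i ≤ n → ω i 1 = H → ω i 0 ≤ xm)
    (hv : ω i₀ = pt xm H) (hrun : ∀ s, 1 ≤ s → s ≤ 2 * k → ω (i₀ + s) = pt (xm + s - 1) (H - 1))
    (hdown : ω (i₀ + 2 * k + 1) = pt (xm + 2 * k - 1) (H - 2)) :
    SpliceAddOK n 2 (2 * k) ω i₀ (tpath (offYs k) (2 * k + 2) xm H true) ∧
      (∀ s, s ≤ 2 * k → ω (i₀ + s) = tpath wYs (2 * k) xm H true s) := by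
  obtain ⟨hE, -⟩ := mem_canonEnd.1 hω
  obtain ⟨⟨h0, -, hbw, hinj⟩, hn'⟩ := mem_endAt_iff.1 hE
  have h1 : ω (i₀ + 1) = pt xm (H - 1) := by rw [hrun 1 le_rfl (by omega)]; congr 1; ring
  have hpar : (xm + H) % 2 = 1 := by
    have hvc := vertical_cases (hbw i₀ (by omega)) (by rw [hv, h1]; simp)
    rw [hv, h1] at hvc; simp only [pt_apply_zero, pt_apply_one] at hvc; omega
  have hlast : ω (i₀ + 2 * k) = pt (xm + 2 * k - 1) (H - 1) := by
    have := hrun (2 * k) (by omega) le_rfl; exact_mod_cast this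
  have hE' := caseYs_free hE hpar hx hk hmaxH hmaxX (a := i₀ + 2 * k) (by omega) (by omega) hlast
    (Or.inl ⟨by rw [show i₀ + 2 * k - 1 = i₀ + (2 * k - 1) by omega, hrun (2 * k - 1) (by omega) (by omega)]; congr 1; omega,
      hdown⟩)
  have hw : ∀ s, s ≤ 2 * k → ω (i₀ + s) = tpath wYs (2 * k) xm H true s := by
    intro s hs
    rcases Nat.eq_zero_or_pos s with rfl | hs0
    · exact tpath_eq (by rw [add_zero, hv]) (by simp [rd, wYs])
    · refine tpath_eq (hrun s hs0 hs) ?_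
      simp only [rd, ↓reduceIte]; rw [wYs_pos hs0, Prod.mk.injEq]; exact ⟨by ring, by ring⟩
  exact ⟨spliceOK_Ys hpar hx hk hmaxH hmaxX hE' hw (by omega), hw⟩

/-- **Roof datum, backward** (run `ω (i₀−s) = (xm+s−1,H−1)`, `1 ≤ s ≤ 2k`, then `ω (i₀−(2k+1)) = (xm+2k−1,H−2)`): the roof surgery with
window at `j = i₀ − 2k`, read backwards, is admissible. [cite: MadrasSlade1993, §3.2 (proof of Theorem 3.2.3)] -/
theorem stepTwo_data_Ys_bwd (hω : ω ∈ canonEnd n) {i₀ : ℕ} (hx : 1 ≤ xm) (hk : 1 ≤ k) (hki : 2 * k + 1 ≤ i₀) (hi₀n : i₀ ≤ n)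
    (hmaxH : ∀ i, i ≤ n → ω i 1 ≤ H) (hmaxX : ∀ i, i ≤ n → ω i 1 = H → ω i 0 ≤ xm)
    (hv : ω i₀ = pt xm H) (hrun : ∀ s, 1 ≤ s → s ≤ 2 * k → ω (i₀ - s) = pt (xm + s - 1) (H - 1))
    (hdown : ω (i₀ - (2 * k + 1)) = pt (xm + 2 * k - 1) (H - 2)) :
    SpliceAddOK n 2 (2 * k) ω (i₀ - 2 * k) (tpath (offYs k) (2 * k + 2) xm H false) ∧
      (∀ s, s ≤ 2 * k → ω (i₀ - 2 * k + s) = tpath wYs (2 * k) xm H false s) := by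
  obtain ⟨hE, -⟩ := mem_canonEnd.1 hω
  obtain ⟨⟨h0, -, hbw, hinj⟩, hn'⟩ := mem_endAt_iff.1 hE
  have h1 : ω (i₀ - 1) = pt xm (H - 1) := by rw [hrun 1 le_rfl (by omega)]; congr 1; ring
  have hpar : (xm + H) % 2 = 1 := by
    have hvc := vertical_cases (hbw (i₀ - 1) (by omega)) (by rw [show i₀ - 1 + 1 = i₀ by omega, hv, h1]; simp)
    rw [show i₀ - 1 + 1 = i₀ by omega, hv, h1] at hvc; simp only [pt_apply_zero, pt_apply_one] at hvc; omega
  have hlast : ω (i₀ - 2 * k) = pt (xm + 2 * k - 1) (H - 1) := by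
    have := hrun (2 * k) (by omega) le_rfl; exact_mod_cast this
  have hE' := caseYs_free hE hpar hx hk hmaxH hmaxX (a := i₀ - 2 * k) (by omega) (by omega) hlast
    (Or.inr ⟨by rw [show i₀ - 2 * k + 1 = i₀ - (2 * k - 1) by omega, hrun (2 * k - 1) (by omega) (by omega)]; congr 1; omega,
      by rw [show i₀ - 2 * k - 1 = i₀ - (2 * k + 1) by omega, hdown]⟩)
  have hw : ∀ s, s ≤ 2 * k → ω (i₀ - 2 * k + s) = tpath wYs (2 * k) xm H false s := by
    intro s hs
    rcases Nat.lt_or_ge s (2 * k) with hs2 | hs2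
    · refine tpath_eq (by rw [show i₀ - 2 * k + s = i₀ - (2 * k - s) by omega, hrun (2 * k - s) (by omega) (by omega)]) ?_
      simp only [rd, Bool.false_eq_true, ↓reduceIte]; rw [wYs_pos (by omega), Prod.mk.injEq]; exact ⟨by ring, by ring⟩
    · obtain rfl : s = 2 * k := by omega
      exact tpath_eq (by rw [show i₀ - 2 * k + 2 * k = i₀ by omega, hv]) (by simp [rd, wYs])
  exact ⟨spliceOK_Ys hpar hx hk hmaxH hmaxX hE' hw (by omega), hw⟩

/-- **Below a top corner NOT of class X, forward**: with `ω (i₀−1) = (xm−1,H)`, `ω (i₀−2) = (xm−2,H)` and `(xm−3,H)` off `ω`, the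
predecessor `ω (i₀−3)` is `(xm−2, H−1)` (left is excluded by hypothesis, up by maximality of `H`; the vertical bond at the odd site
`(xm−2,H)` goes down). [cite: EntingJensen2009, §7.4.2, Fig. 7.10 (brickwork form of the honeycomb lattice)] -/
theorem notX_pred_fwd {i₀ : ℕ} (hω : ω ∈ endAt n (Pi.single 0 1 : Site 2)) (hpar : (xm + H) % 2 = 1) (hH : 1 ≤ H)
    (hmaxH : ∀ i, i ≤ n → ω i 1 ≤ H) (hi₀ : 2 ≤ i₀) (hi₀n : i₀ ≤ n)
    (h2 : ω (i₀ - 2) = pt (xm - 2) H) (h1 : ω (i₀ - 1) = pt (xm - 1) H) (hX : ∀ t, t ≤ n → ω t ≠ pt (xm - 3) H) :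
    3 ≤ i₀ ∧ ω (i₀ - 3) = pt (xm - 2) (H - 1) := by
  obtain ⟨⟨h0, -, hbw, hinj⟩, hn'⟩ := mem_endAt_iff.1 hω
  have hne : i₀ - 2 ≠ 0 := by
    intro h; rw [h, h0] at h2; have := congrFun h2 1; simp at this; omega
  refine ⟨by omega, ?_⟩
  have hadj : brickWallGraph.Adj (ω (i₀ - 2)) (ω (i₀ - 3)) := by
    have := hbw (i₀ - 3) (by omega); rw [show i₀ - 3 + 1 = i₀ - 2 by omega] at this; exact this.symm
  rw [h2] at hadj
  have hback : ω (i₀ - 3) ≠ ω (i₀ - 1) := by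
    intro h; have := hinj (show i₀ - 3 ∈ {i | i ≤ n} by simp; omega) (show i₀ - 1 ∈ {i | i ≤ n} by simp; omega) h; omega
  have hHt := hmaxH (i₀ - 3) (by omega)
  rcases adj_cases hadj with ⟨hz0, hz1⟩ | ⟨hz0, hz1⟩ | hz0
  · exfalso; apply hback; rw [h1, ys_site_eq_iff]; simp only [pt_apply_zero, pt_apply_one] at hz0 hz1 ⊢; omega
  · exfalso; apply hX (i₀ - 3) (by omega); rw [ys_site_eq_iff]; simp only [pt_apply_zero, pt_apply_one] at hz0 hz1 ⊢; omega
  · rcases vertical_cases hadj hz0 with ⟨hy, hp⟩ | ⟨hy, hp⟩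
    · exfalso; simp only [pt_apply_one] at hy; omega
    · rw [ys_site_eq_iff]; simp only [pt_apply_zero, pt_apply_one] at hz0 hy ⊢; omega

/-- **Below a top corner NOT of class X, backward**: with `ω (i₀+1) = (xm−1,H)`, `ω (i₀+2) = (xm−2,H)` and `(xm−3,H)` off `ω`, the
successor `ω (i₀+3)` is `(xm−2, H−1)` (and `i₀ + 3 ≤ n`). [cite: EntingJensen2009, §7.4.2, Fig. 7.10 (brickwork form of the honeycomb lattice)] -/
theorem notX_succ_bwd {i₀ : ℕ} (hω : ω ∈ endAt n (Pi.single 0 1 : Site 2)) (hpar : (xm + H) % 2 = 1) (hH : 1 ≤ H)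
    (hmaxH : ∀ i, i ≤ n → ω i 1 ≤ H) (hi₀n : i₀ + 2 ≤ n)
    (h2 : ω (i₀ + 2) = pt (xm - 2) H) (h1 : ω (i₀ + 1) = pt (xm - 1) H) (hX : ∀ t, t ≤ n → ω t ≠ pt (xm - 3) H) :
    i₀ + 3 ≤ n ∧ ω (i₀ + 3) = pt (xm - 2) (H - 1) := by
  obtain ⟨⟨h0, -, hbw, hinj⟩, hn'⟩ := mem_endAt_iff.1 hω
  have hne : i₀ + 2 ≠ n := by
    intro h; rw [h, hn'] at h2; have := congrFun h2 1; simp at this; omega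
  refine ⟨by omega, ?_⟩
  have hadj : brickWallGraph.Adj (ω (i₀ + 2)) (ω (i₀ + 3)) := hbw (i₀ + 2) (by omega)
  rw [h2] at hadj
  have hback : ω (i₀ + 3) ≠ ω (i₀ + 1) := by
    intro h; have := hinj (show i₀ + 3 ∈ {i | i ≤ n} by simp; omega) (show i₀ + 1 ∈ {i | i ≤ n} by simp; omega) h; omega
  have hHt := hmaxH (i₀ + 3) (by omega)
  rcases adj_cases hadj with ⟨hz0, hz1⟩ | ⟨hz0, hz1⟩ | hz0
  · exfalso; apply hback; rw [h1, ys_site_eq_iff]; simp only [pt_apply_zero, pt_apply_one] at hz0 hz1 ⊢; omega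
  · exfalso; apply hX (i₀ + 3) (by omega); rw [ys_site_eq_iff]; simp only [pt_apply_zero, pt_apply_one] at hz0 hz1 ⊢; omega
  · rcases vertical_cases hadj hz0 with ⟨hy, hp⟩ | ⟨hy, hp⟩
    · exfalso; simp only [pt_apply_one] at hy; omega
    · rw [ys_site_eq_iff]; simp only [pt_apply_zero, pt_apply_one] at hz0 hy ⊢; omega


/-! ### Classification: class X, the roof move, or the top-right cell is an up-right leaf -/

/-- **Classification at the top corner**: for a canonical rooted polygon (`n ≥ 5`) with top corner `(xm,H) = ω i₀` EITHER `(xm−3,H)`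
is on `ω` (class X of `HexSAWPolygonStepTwoMain`), OR `(xm−3,H)` is off `ω` and below the corner the walk steps down and then RIGHT —
in which case it runs along the row `H−1` for an odd number `2k−1 ≥ 1` of steps and then steps down (the roof move `Y⋆_k` applies; the
three sites before/after the corner along the top row are recorded for the decoding) — OR it steps down and then LEFT: the top-right
hexagon of the polygon is attached to the rest through its lower-left edge only («up-right leaf»).
[cite: MadrasSlade1993, §3.2 (proof of Theorem 3.2.3: the local structure at the lexicographically largest point)] -/
theorem stepTwo_classify_roof (hω : ω ∈ canonEnd n) (hn : 5 ≤ n) :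
    ∃ (H xm : ℤ) (i₀ : ℕ) (fwd : Bool), 1 ≤ i₀ ∧ i₀ + 1 ≤ n ∧ ω i₀ = pt xm H ∧ 2 ≤ xm ∧ 1 ≤ H ∧
      (∀ i, i ≤ n → ω i 1 ≤ H) ∧ (∀ i, i ≤ n → ω i 1 = H → ω i 0 ≤ xm) ∧
      ( (∃ t, t ≤ n ∧ ω t = pt (xm - 3) H) ∨
        ((∀ t, t ≤ n → ω t ≠ pt (xm - 3) H) ∧
          ( (fwd = true ∧ 3 ≤ i₀ ∧ ω (i₀ - 1) = pt (xm - 1) H ∧ ω (i₀ - 2) = pt (xm - 2) H ∧ ω (i₀ - 3) = pt (xm - 2) (H - 1) ∧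
              ∃ k, 1 ≤ k ∧ i₀ + 2 * k + 1 ≤ n ∧ (∀ s, 1 ≤ s → s ≤ 2 * k → ω (i₀ + s) = pt (xm + s - 1) (H - 1)) ∧
                ω (i₀ + 2 * k + 1) = pt (xm + 2 * k - 1) (H - 2)) ∨
            (fwd = false ∧ i₀ + 3 ≤ n ∧ ω (i₀ + 1) = pt (xm - 1) H ∧ ω (i₀ + 2) = pt (xm - 2) H ∧ ω (i₀ + 3) = pt (xm - 2) (H - 1) ∧
              ∃ k, 1 ≤ k ∧ 2 * k + 1 ≤ i₀ ∧ (∀ s, 1 ≤ s → s ≤ 2 * k → ω (i₀ - s) = pt (xm + s - 1) (H - 1)) ∧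
                ω (i₀ - (2 * k + 1)) = pt (xm + 2 * k - 1) (H - 2)) ∨
            (fwd = true ∧ i₀ + 2 ≤ n ∧ ω (i₀ + 1) = pt xm (H - 1) ∧ ω (i₀ + 2) = pt (xm - 1) (H - 1)) ∨
            (fwd = false ∧ 2 ≤ i₀ ∧ ω (i₀ - 1) = pt xm (H - 1) ∧ ω (i₀ - 2) = pt (xm - 1) (H - 1))))) := by
  obtain ⟨hE, hlex⟩ := mem_canonEnd.1 hω
  obtain ⟨⟨h0, -, hbw, hinj⟩, hn'⟩ := mem_endAt_iff.1 hE
  have hcol := col_nonneg_of_mem_canonEnd hω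
  obtain ⟨H, xm, i₀, hi₀, hi₀n, hv, hH1, hmaxH, hmaxX, hdir⟩ := exists_top_corner hω (by omega)
  rcases hdir with ⟨hp, hs⟩ | ⟨hs', hp'⟩
  · -- forward: `ω (i₀−1) = (xm−1,H)`, `ω (i₀+1) = (xm,H−1)`
    have hpar : (xm + H) % 2 = 1 := by
      have hvc := vertical_cases (hbw i₀ (by omega)) (by rw [hv, hs]; simp)
      rw [hv, hs] at hvc; simp only [pt_apply_zero, pt_apply_one] at hvc; omega
    obtain ⟨hi₀2, h2⟩ := top_corner_pred hω hi₀ hi₀n hv hmaxH hp hs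
    have hx2 : 2 ≤ xm := by have := hcol (i₀ - 2); rw [h2] at this; simp only [pt_apply_zero] at this; omega
    refine ⟨H, xm, i₀, true, hi₀, hi₀n, hv, hx2, hH1, hmaxH, hmaxX, ?_⟩
    by_cases hX : ∃ t, t ≤ n ∧ ω t = pt (xm - 3) H
    · exact Or.inl hX
    push Not at hX
    refine Or.inr ⟨hX, ?_⟩
    obtain ⟨hi₀3, h3⟩ := notX_pred_fwd hE hpar hH1 hmaxH hi₀2 (by omega) h2 hp hX
    obtain ⟨hi₀2', hstep⟩ := caseY_step1_fwd hE hpar hx2 hi₀n hv hs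
    rcases hstep with hL | hR
    · exact Or.inr (Or.inr (Or.inl ⟨rfl, hi₀2', hs, hL⟩))
    · obtain ⟨k, hk, hkn, hrun, hdown⟩ := exists_roof_run_fwd hE hpar hx2 hmaxX hi₀2' hs hR
      exact Or.inl ⟨rfl, hi₀3, hp, h2, h3, k, hk, hkn, hrun, hdown⟩
  · -- backward: `ω (i₀+1) = (xm−1,H)`, `ω (i₀−1) = (xm,H−1)`
    have hpar : (xm + H) % 2 = 1 := by
      have hvc := vertical_cases (hbw (i₀ - 1) (by omega)) (by rw [show i₀ - 1 + 1 = i₀ by omega, hv, hp']; simp)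
      rw [show i₀ - 1 + 1 = i₀ by omega, hv, hp'] at hvc; simp only [pt_apply_zero, pt_apply_one] at hvc; omega
    obtain ⟨hi₀2, h2⟩ := top_corner_succ hω hi₀ hi₀n hv hmaxH hs' hp'
    have hx2 : 2 ≤ xm := by have := hcol (i₀ + 2); rw [h2] at this; simp only [pt_apply_zero] at this; omega
    refine ⟨H, xm, i₀, false, hi₀, hi₀n, hv, hx2, hH1, hmaxH, hmaxX, ?_⟩
    by_cases hX : ∃ t, t ≤ n ∧ ω t = pt (xm - 3) H
    · exact Or.inl hX
    push Not at hX
    refine Or.inr ⟨hX, ?_⟩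
    obtain ⟨hi₀3, h3⟩ := notX_succ_bwd hE hpar hH1 hmaxH hi₀2 h2 hs' hX
    obtain ⟨hi₀2', hstep⟩ := caseY_step1_bwd hE hpar hx2 hi₀ (by omega) hv hp'
    rcases hstep with hL | hR
    · exact Or.inr (Or.inr (Or.inr ⟨rfl, hi₀2', hp', hL⟩))
    · obtain ⟨k, hk, hki, hrun, hdown⟩ := exists_roof_run_bwd hE hpar hx2 hmaxX hi₀2' (by omega) hp' hR
      exact Or.inr (Or.inl ⟨rfl, hi₀3, hs', h2, h3, k, hk, hki, hrun, hdown⟩)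

/-! ### Decoding the roof images -/

/-- **Top corner of a roof image**: `(xm + 2k, H)`, at table index `2k`. [cite: MadrasSlade1993, §3.2] -/
theorem topAt_spliceYs (hmaxH : ∀ i, i ≤ n → ω i 1 ≤ H) (hmaxX : ∀ i, i ≤ n → ω i 1 = H → ω i 0 ≤ xm)
    (hP : SpliceAddOK n 2 (2 * k) ω j (tpath (offYs k) (2 * k + 2) xm H fwd)) :
    TopSix (n + 2) (spliceAdd 2 (2 * k) ω (tpath (offYs k) (2 * k + 2) xm H fwd) j) (H + 0) (xm + 2 * k)
      (j + rd fwd (2 * k + 2) (2 * k)) := by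
  have htab : ∀ u, u ≤ 2 * k + 2 → (offYs k u).2 ≤ 0 ∧ ((offYs k u).2 = 0 → (offYs k u).1 ≤ 2 * (k : ℤ)) := by
    intro u hu
    unfold offYs
    split_ifs with h1 h2
    · exact ⟨le_rfl, fun _ => by change (u : ℤ) ≤ 2 * (k : ℤ); exact_mod_cast h1⟩
    · exact ⟨by change (-1 : ℤ) ≤ 0; norm_num, fun h => absurd h (by change (-1 : ℤ) ≠ 0; norm_num)⟩
    · exact ⟨by change (-1 : ℤ) ≤ 0; norm_num, fun h => absurd h (by change (-1 : ℤ) ≠ 0; norm_num)⟩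
  exact topAt_spliceAdd (dH := 0) (dX := 2 * (k : ℤ)) hmaxH hmaxX hP le_rfl (fun _ => by positivity) htab (u₀ := 2 * k)
    (by omega) (by simp [offYs])

/-- **Sites of a roof image, forward** (window at `j`): the roof `(xm+u, H)` at times `j+u` (`u ≤ 2k`), then `(xm+2k, H−1)` at
`j+2k+1` and `(xm+2k−1, H−1)` at `j+2k+2`. [cite: MadrasSlade1993, §3.2 (proof of Theorem 3.2.3)] -/
theorem spliceYs_sites_fwd (hP : SpliceAddOK n 2 (2 * k) ω j (tpath (offYs k) (2 * k + 2) xm H true)) :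
    (∀ u, u ≤ 2 * k → spliceAdd 2 (2 * k) ω (tpath (offYs k) (2 * k + 2) xm H true) j (j + u) = pt (xm + u) H) ∧
    spliceAdd 2 (2 * k) ω (tpath (offYs k) (2 * k + 2) xm H true) j (j + (2 * k + 1)) = pt (xm + 2 * k) (H - 1) ∧
    spliceAdd 2 (2 * k) ω (tpath (offYs k) (2 * k + 2) xm H true) j (j + (2 * k + 2)) = pt (xm + 2 * k - 1) (H - 1) := by
  refine ⟨fun u hu => ?_, ?_, ?_⟩
  · rw [spliceAdd_mid hP.start (by omega)]; simp only [tpath, rd, ↓reduceIte]; unfold offYs; rw [if_pos hu]; simp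
  · rw [spliceAdd_mid hP.start (by omega)]; simp only [tpath, rd, ↓reduceIte]; unfold offYs
    rw [if_neg (by omega), if_pos rfl]; exact pt_inj.2 ⟨rfl, by ring⟩
  · rw [spliceAdd_mid hP.start (by omega)]; simp only [tpath, rd, ↓reduceIte]; unfold offYs
    rw [if_neg (by omega), if_neg (by omega)]; exact pt_inj.2 ⟨by ring, by ring⟩

/-- **Sites of a roof image, backward** (window at `j`): `(xm+2k−1,H−1)` at `j`, `(xm+2k,H−1)` at `j+1`, then the roof `(xm+2k−u, H)` at
times `j+2+u` (`u ≤ 2k`). [cite: MadrasSlade1993, §3.2 (proof of Theorem 3.2.3)] -/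
theorem spliceYs_sites_bwd (hP : SpliceAddOK n 2 (2 * k) ω j (tpath (offYs k) (2 * k + 2) xm H false)) :
    (∀ u, u ≤ 2 * k → spliceAdd 2 (2 * k) ω (tpath (offYs k) (2 * k + 2) xm H false) j (j + (2 + u)) = pt (xm + 2 * k - u) H) ∧
    spliceAdd 2 (2 * k) ω (tpath (offYs k) (2 * k + 2) xm H false) j (j + 1) = pt (xm + 2 * k) (H - 1) ∧
    spliceAdd 2 (2 * k) ω (tpath (offYs k) (2 * k + 2) xm H false) j j = pt (xm + 2 * k - 1) (H - 1) := by
  refine ⟨fun u hu => ?_, ?_, ?_⟩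
  · rw [spliceAdd_mid hP.start (by omega)]; simp only [tpath, rd, Bool.false_eq_true, ↓reduceIte]; unfold offYs
    rw [if_pos (by omega)]; exact pt_inj.2 ⟨by omega, by ring⟩
  · rw [spliceAdd_mid hP.start (by omega)]; simp only [tpath, rd, Bool.false_eq_true, ↓reduceIte]; unfold offYs
    rw [if_neg (by omega), if_pos (by omega)]; exact pt_inj.2 ⟨rfl, by ring⟩
  · have h := spliceAdd_mid (K := 2) (L := 2 * k) (ω := ω) (j := j) hP.start (s := 0) (by omega)
    rw [add_zero] at h; rw [h]; simp only [tpath, rd, Bool.false_eq_true, ↓reduceIte]; unfold offYs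
    rw [if_neg (by omega), if_neg (by omega)]; exact pt_inj.2 ⟨by ring, by ring⟩

/-- **Heights around a roof image's corner, forward** (with the three pre-window sites of a source NOT of class X): the sites at times
`j−2, …, j+2k` all have height `H`, the site at time `j−3` has height `H−1`. [cite: MadrasSlade1993, §3.2 (proof of Theorem 3.2.3)] -/
theorem spliceYs_heights_fwd (hP : SpliceAddOK n 2 (2 * k) ω j (tpath (offYs k) (2 * k + 2) xm H true)) (hj : 3 ≤ j)
    (hp1 : ω (j - 1) = pt (xm - 1) H) (hp2 : ω (j - 2) = pt (xm - 2) H) (hp3 : ω (j - 3) = pt (xm - 2) (H - 1)) :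
    (∀ i, j - 2 ≤ i → i ≤ j + 2 * k → spliceAdd 2 (2 * k) ω (tpath (offYs k) (2 * k + 2) xm H true) j i 1 = H) ∧
    spliceAdd 2 (2 * k) ω (tpath (offYs k) (2 * k + 2) xm H true) j (j - 3) 1 = H - 1 := by
  refine ⟨fun i hi1 hi2 => ?_, by rw [spliceAdd_of_le (by omega), hp3]; simp⟩
  rcases Nat.lt_or_ge i j with h | h
  · rw [spliceAdd_of_le h.le]
    rcases Nat.lt_or_ge i (j - 1) with h' | h'
    · rw [show i = j - 2 by omega, hp2]; simp
    · rw [show i = j - 1 by omega, hp1]; simp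
  · obtain ⟨u, rfl⟩ : ∃ u, i = j + u := ⟨i - j, by omega⟩
    rw [(spliceYs_sites_fwd hP).1 u (by omega)]; simp

/-- **Heights around a roof image's corner, backward** (with the three post-window sites of a source NOT of class X): the sites at times
`j+2, …, j+2k+4` have height `H`, the site at time `j+2k+5` has height `H−1`. [cite: MadrasSlade1993, §3.2 (proof of Theorem 3.2.3)] -/
theorem spliceYs_heights_bwd (hP : SpliceAddOK n 2 (2 * k) ω j (tpath (offYs k) (2 * k + 2) xm H false))
    (hs1 : ω (j + 2 * k + 1) = pt (xm - 1) H) (hs2 : ω (j + 2 * k + 2) = pt (xm - 2) H) (hs3 : ω (j + 2 * k + 3) = pt (xm - 2) (H - 1)) :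
    (∀ i, j + 2 ≤ i → i ≤ j + 2 * k + 4 → spliceAdd 2 (2 * k) ω (tpath (offYs k) (2 * k + 2) xm H false) j i 1 = H) ∧
    spliceAdd 2 (2 * k) ω (tpath (offYs k) (2 * k + 2) xm H false) j (j + 2 * k + 5) 1 = H - 1 := by
  refine ⟨fun i hi1 hi2 => ?_, ?_⟩
  · rcases Nat.lt_or_ge i (j + 2 * k + 3) with h | h
    · obtain ⟨u, rfl⟩ : ∃ u, i = j + (2 + u) := ⟨i - j - 2, by omega⟩
      rw [(spliceYs_sites_bwd hP).1 u (by omega)]; simp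
    · rw [spliceAdd_of_ge hP.finish (by omega)]
      rcases Nat.lt_or_ge i (j + 2 * k + 4) with h' | h'
      · rw [show i - 2 = j + 2 * k + 1 by omega, hs1]; simp
      · rw [show i - 2 = j + 2 * k + 2 by omega, hs2]; simp
  · rw [spliceAdd_of_ge hP.finish (by omega), show j + 2 * k + 5 - 2 = j + 2 * k + 3 by omega, hs3]; simp


/-- **Decoding within the roof class**: two canonical polygons NOT of class X with roof surgeries (any corners, run lengths `k₁, k₂`,
orientations, window positions; the three sites before/after the window along the top row recorded) whose images coincide are EQUAL.
The image's intrinsic top corner pins `H`, `xm + 2k` and the corner time; the site after the corner time pins the orientation (DOWN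
forward, LEFT along the roof backward); the top-row run ending at the corner has exactly `2k + 3` sites, which pins `k`; then
`eq_of_spliceAdd_eq` reads `ω` off. [cite: MadrasSlade1993, §3.2 (proof of Theorem 3.2.3: "Q can be unambiguously determined")] -/
theorem spliceYs_decode {ω₁ ω₂ : ℕ → Site 2} {xm₁ H₁ xm₂ H₂ : ℤ} {j₁ j₂ k₁ k₂ : ℕ} {fwd₁ fwd₂ : Bool}
    (hω₁ : ω₁ ∈ canonEnd n) (hω₂ : ω₂ ∈ canonEnd n) (hk₁ : 1 ≤ k₁) (hk₂ : 1 ≤ k₂)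
    (hmaxH₁ : ∀ i, i ≤ n → ω₁ i 1 ≤ H₁) (hmaxX₁ : ∀ i, i ≤ n → ω₁ i 1 = H₁ → ω₁ i 0 ≤ xm₁)
    (hmaxH₂ : ∀ i, i ≤ n → ω₂ i 1 ≤ H₂) (hmaxX₂ : ∀ i, i ≤ n → ω₂ i 1 = H₂ → ω₂ i 0 ≤ xm₂)
    (hP₁ : SpliceAddOK n 2 (2 * k₁) ω₁ j₁ (tpath (offYs k₁) (2 * k₁ + 2) xm₁ H₁ fwd₁))
    (hP₂ : SpliceAddOK n 2 (2 * k₂) ω₂ j₂ (tpath (offYs k₂) (2 * k₂ + 2) xm₂ H₂ fwd₂))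
    (hw₁ : ∀ s, s ≤ 2 * k₁ → ω₁ (j₁ + s) = tpath wYs (2 * k₁) xm₁ H₁ fwd₁ s)
    (hw₂ : ∀ s, s ≤ 2 * k₂ → ω₂ (j₂ + s) = tpath wYs (2 * k₂) xm₂ H₂ fwd₂ s)
    (hpre₁ : fwd₁ = true → 3 ≤ j₁ ∧ ω₁ (j₁ - 1) = pt (xm₁ - 1) H₁ ∧ ω₁ (j₁ - 2) = pt (xm₁ - 2) H₁ ∧ ω₁ (j₁ - 3) = pt (xm₁ - 2) (H₁ - 1))
    (hpost₁ : fwd₁ = false → ω₁ (j₁ + 2 * k₁ + 1) = pt (xm₁ - 1) H₁ ∧ ω₁ (j₁ + 2 * k₁ + 2) = pt (xm₁ - 2) H₁ ∧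
      ω₁ (j₁ + 2 * k₁ + 3) = pt (xm₁ - 2) (H₁ - 1))
    (hpre₂ : fwd₂ = true → 3 ≤ j₂ ∧ ω₂ (j₂ - 1) = pt (xm₂ - 1) H₂ ∧ ω₂ (j₂ - 2) = pt (xm₂ - 2) H₂ ∧ ω₂ (j₂ - 3) = pt (xm₂ - 2) (H₂ - 1))
    (hpost₂ : fwd₂ = false → ω₂ (j₂ + 2 * k₂ + 1) = pt (xm₂ - 1) H₂ ∧ ω₂ (j₂ + 2 * k₂ + 2) = pt (xm₂ - 2) H₂ ∧
      ω₂ (j₂ + 2 * k₂ + 3) = pt (xm₂ - 2) (H₂ - 1))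
    (h : spliceAdd 2 (2 * k₁) ω₁ (tpath (offYs k₁) (2 * k₁ + 2) xm₁ H₁ fwd₁) j₁ =
      spliceAdd 2 (2 * k₂) ω₂ (tpath (offYs k₂) (2 * k₂ + 2) xm₂ H₂ fwd₂) j₂) : ω₁ = ω₂ := by
  obtain ⟨hE₁, -⟩ := mem_canonEnd.1 hω₁
  obtain ⟨hE₂, -⟩ := mem_canonEnd.1 hω₂
  have hW : spliceAdd 2 (2 * k₁) ω₁ (tpath (offYs k₁) (2 * k₁ + 2) xm₁ H₁ fwd₁) j₁ ∈ endAt (n + 2) (Pi.single 0 1 : Site 2) :=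
    spliceAdd_mem hE₁ hP₁
  have hinj := (mem_endAt_iff.1 hW).1.2.2.2
  have T₁ := topAt_spliceYs hmaxH₁ hmaxX₁ hP₁
  have T₂ := topAt_spliceYs hmaxH₂ hmaxX₂ hP₂
  rw [← h] at T₂
  obtain ⟨eH, ex, eτ⟩ := topAt_unique hinj T₁ T₂
  have eH' : H₁ = H₂ := by omega
  subst eH'
  cases fwd₁ <;> cases fwd₂ <;> simp only [rd, Bool.false_eq_true, ↓reduceIte] at eτ
  · -- both backward: corner times `j₁ + 2 = j₂ + 2`
    have ej : j₁ = j₂ := by omega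
    subst ej
    obtain ⟨q1, q2, q3⟩ := hpost₁ rfl
    obtain ⟨r1, r2, r3⟩ := hpost₂ rfl
    have A₁ := spliceYs_heights_bwd hP₁ q1 q2 q3
    have A₂ := spliceYs_heights_bwd hP₂ r1 r2 r3
    rw [← h] at A₂
    have ek : k₁ = k₂ := by
      rcases Nat.lt_trichotomy k₁ k₂ with hlt | heq | hgt
      · exfalso
        have a := A₁.2; have b := A₂.1 (j₁ + 2 * k₁ + 5) (by omega) (by omega)
        rw [a] at b; omega
      · exact heq
      · exfalso
        have a := A₂.2; have b := A₁.1 (j₁ + 2 * k₂ + 5) (by omega) (by omega)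
        rw [a] at b; omega
    subst ek
    have exm : xm₁ = xm₂ := by omega
    subst exm
    exact eq_of_spliceAdd_eq hE₁ hE₂ hP₁ hP₂ hw₁ hw₂ h
  · -- ω₁ backward (corner at j₁+2), ω₂ forward (corner at j₂+2k₂): the site after the corner time
    exfalso
    have a := (spliceYs_sites_bwd hP₁).1 1 (by omega)   -- time j₁ + 3: height H₁
    have b := (spliceYs_sites_fwd hP₂).2.1               -- time j₂ + 2k₂ + 1: height H₁ − 1
    rw [← h, show j₂ + (2 * k₂ + 1) = j₁ + (2 + 1) by omega, a] at b
    have := (pt_inj.1 b).2; omega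
  · exfalso
    have a := (spliceYs_sites_bwd hP₂).1 1 (by omega)
    have b := (spliceYs_sites_fwd hP₁).2.1
    rw [h, show j₁ + (2 * k₁ + 1) = j₂ + (2 + 1) by omega, a] at b
    have := (pt_inj.1 b).2; omega
  · -- both forward: corner times `j₁ + 2k₁ = j₂ + 2k₂`
    obtain ⟨hj₁, q1, q2, q3⟩ := hpre₁ rfl
    obtain ⟨hj₂, r1, r2, r3⟩ := hpre₂ rfl
    have A₁ := spliceYs_heights_fwd hP₁ hj₁ q1 q2 q3
    have A₂ := spliceYs_heights_fwd hP₂ hj₂ r1 r2 r3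
    rw [← h] at A₂
    have ek : k₁ = k₂ := by
      rcases Nat.lt_trichotomy k₁ k₂ with hlt | heq | hgt
      · exfalso
        have a := A₁.2; have b := A₂.1 (j₁ - 3) (by omega) (by omega)
        rw [a] at b; omega
      · exact heq
      · exfalso
        have a := A₂.2; have b := A₁.1 (j₂ - 3) (by omega) (by omega)
        rw [a] at b; omega
    subst ek
    have ej : j₁ = j₂ := by omega
    subst ej
    have exm : xm₁ = xm₂ := by omega
    subst exm
    exact eq_of_spliceAdd_eq hE₁ hE₂ hP₁ hP₂ hw₁ hw₂ h

/-- **Case-X images and roof images are disjoint**: if a case-X image (corner data `xm₁, H₁`, orientation `fwd₁`, with the old-corner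
facts of `stepTwo_data_X`) equals a roof image, compare the sites next to the common intrinsic top corner: below the corner a case-X image
turns RIGHT (to the old corner), a roof image turns LEFT. [cite: MadrasSlade1993, §3.2 (proof of Theorem 3.2.3)] -/
theorem spliceX_ne_spliceYs {ω₁ ω₂ : ℕ → Site 2} {xm₁ H₁ xm₂ H₂ : ℤ} {j₁ j₂ k₂ : ℕ} {fwd₁ fwd₂ : Bool}
    (hω₁ : ω₁ ∈ canonEnd n) (hk₂ : 1 ≤ k₂)
    (hmaxH₁ : ∀ i, i ≤ n → ω₁ i 1 ≤ H₁) (hmaxX₁ : ∀ i, i ≤ n → ω₁ i 1 = H₁ → ω₁ i 0 ≤ xm₁)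
    (hmaxH₂ : ∀ i, i ≤ n → ω₂ i 1 ≤ H₂) (hmaxX₂ : ∀ i, i ≤ n → ω₂ i 1 = H₂ → ω₂ i 0 ≤ xm₂)
    (hP₁ : SpliceAddOK n 2 2 ω₁ j₁ (tpath offX 4 xm₁ H₁ fwd₁))
    (hP₂ : SpliceAddOK n 2 (2 * k₂) ω₂ j₂ (tpath (offYs k₂) (2 * k₂ + 2) xm₂ H₂ fwd₂))
    (hvf₁ : fwd₁ = true → ω₁ (j₁ + 3) = pt xm₁ H₁) (hvb₁ : fwd₁ = false → 1 ≤ j₁ ∧ ω₁ (j₁ - 1) = pt xm₁ H₁)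
    (h : spliceAdd 2 2 ω₁ (tpath offX 4 xm₁ H₁ fwd₁) j₁ = spliceAdd 2 (2 * k₂) ω₂ (tpath (offYs k₂) (2 * k₂ + 2) xm₂ H₂ fwd₂) j₂) :
    False := by
  obtain ⟨hE₁, -⟩ := mem_canonEnd.1 hω₁
  have hW : spliceAdd 2 2 ω₁ (tpath offX 4 xm₁ H₁ fwd₁) j₁ ∈ endAt (n + 2) (Pi.single 0 1 : Site 2) := spliceAdd_mem hE₁ hP₁
  have hinj := (mem_endAt_iff.1 hW).1.2.2.2
  have T₁ := topAt_spliceX hmaxH₁ hmaxX₁ hP₁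
  have T₂ := topAt_spliceYs hmaxH₂ hmaxX₂ hP₂
  rw [← h] at T₂
  obtain ⟨eH, ex, eτ⟩ := topAt_unique hinj T₁ T₂
  cases fwd₁ <;> cases fwd₂ <;> simp only [rd, Bool.false_eq_true, ↓reduceIte] at eτ
  · -- X backward (corner at j₁+1), roof backward (corner at j₂+2): compare time corner − 2
    obtain ⟨hj₁, hv⟩ := hvb₁ rfl
    have e : spliceAdd 2 2 ω₁ (tpath offX 4 xm₁ H₁ false) j₁ (j₁ - 1) = pt xm₁ H₁ := by rw [spliceAdd_of_le (by omega), hv]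
    have b := (spliceYs_sites_bwd hP₂).2.2
    rw [← h, show j₂ = j₁ - 1 by omega, e] at b
    have := (pt_inj.1 b).1; omega
  · -- X backward, roof forward (corner at j₂+2k₂): compare time corner − 1
    obtain ⟨-, h0, -⟩ := spliceX_signature_bwd hP₁ (hvb₁ rfl).1 (hvb₁ rfl).2
    have b := (spliceYs_sites_fwd hP₂).1 (2 * k₂ - 1) (by omega)
    rw [← h, show j₂ + (2 * k₂ - 1) = j₁ by omega, h0] at b
    have := (pt_inj.1 b).2; omega
  · -- X forward (corner at j₁+3), roof backward (corner at j₂+2): compare time corner + 1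
    obtain ⟨-, h4, -⟩ := spliceX_signature_fwd hP₁ (hvf₁ rfl)
    have b := (spliceYs_sites_bwd hP₂).1 1 (by omega)
    rw [← h, show j₂ + (2 + 1) = j₁ + 4 by omega, h4] at b
    have := (pt_inj.1 b).2; omega
  · -- both forward: compare time corner + 2
    obtain ⟨-, -, h5⟩ := spliceX_signature_fwd hP₁ (hvf₁ rfl)
    have b := (spliceYs_sites_fwd hP₂).2.2
    rw [← h, show j₂ + (2 * k₂ + 2) = j₁ + 5 by omega, h5] at b
    have := (pt_inj.1 b).1; omega

end Roof

/-! ### The classes X ∪ Y⋆ and the injection they carry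

`IsStepTwoRoof n ω`: at the top corner of `ω`, class X, or the roof configuration (forward / backward) with its run length `k ≥ 1` and
the three top-row sites on the other side of the corner; `IsTopLeaf n ω`: `(xm−3,H)` off `ω` and a step LEFT below the corner.  Every
canonical rooted polygon with `n ≥ 5` is in one of the two (`isStepTwoRoof_or_isTopLeaf`), and on `IsStepTwoRoof` the surgeries are a
well-defined INJECTION into `canonEnd (n+2)` (`card_filter_isStepTwoRoof_le`). -/

section RoofMain

/-- **Classes X ∪ Y⋆ of the step-two line**: some top-corner datum `(H, xm, i₀)` of `ω` with EITHER `(xm−3, H)` on `ω` (class X) OR the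
roof configuration: along the top row the corner is preceded (forward) / followed (backward) by `(xm−1,H), (xm−2,H), (xm−2,H−1)`, and
below the corner the walk runs right along the row `H−1` for `2k−1` steps and then steps down.
[cite: MadrasSlade1993, §3.2 (proof of Theorem 3.2.3: surgery at the lexicographically largest point)] -/
def IsStepTwoRoof (n : ℕ) (ω : ℕ → Site 2) : Prop :=
  ∃ (H xm : ℤ) (i₀ : ℕ), i₀ + 1 ≤ n ∧ ω i₀ = pt xm H ∧ 2 ≤ xm ∧
    (∀ i, i ≤ n → ω i 1 ≤ H) ∧ (∀ i, i ≤ n → ω i 1 = H → ω i 0 ≤ xm) ∧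
    ((∃ t, t ≤ n ∧ ω t = pt (xm - 3) H) ∨
      (3 ≤ i₀ ∧ ω (i₀ - 1) = pt (xm - 1) H ∧ ω (i₀ - 2) = pt (xm - 2) H ∧ ω (i₀ - 3) = pt (xm - 2) (H - 1) ∧
        ∃ k, 1 ≤ k ∧ i₀ + 2 * k + 1 ≤ n ∧ (∀ s, 1 ≤ s → s ≤ 2 * k → ω (i₀ + s) = pt (xm + s - 1) (H - 1)) ∧
          ω (i₀ + 2 * k + 1) = pt (xm + 2 * k - 1) (H - 2)) ∨
      (i₀ + 3 ≤ n ∧ ω (i₀ + 1) = pt (xm - 1) H ∧ ω (i₀ + 2) = pt (xm - 2) H ∧ ω (i₀ + 3) = pt (xm - 2) (H - 1) ∧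
        ∃ k, 1 ≤ k ∧ 2 * k + 1 ≤ i₀ ∧ (∀ s, 1 ≤ s → s ≤ 2 * k → ω (i₀ - s) = pt (xm + s - 1) (H - 1)) ∧
          ω (i₀ - (2 * k + 1)) = pt (xm + 2 * k - 1) (H - 2)))

/-- **The leaf class** (the residue of this file): a top-corner datum with `(xm−3, H)` OFF `ω` and, below the corner, a step LEFT — the
top-right hexagon `[xm−2,xm]×[H−1,H]` of the polygon is attached through its lower-left edge only.
[cite: MadrasSlade1993, §3.2 (proof of Theorem 3.2.3)] -/
def IsTopLeaf (n : ℕ) (ω : ℕ → Site 2) : Prop :=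
  ∃ (H xm : ℤ) (i₀ : ℕ), i₀ + 1 ≤ n ∧ ω i₀ = pt xm H ∧ 2 ≤ xm ∧
    (∀ i, i ≤ n → ω i 1 ≤ H) ∧ (∀ i, i ≤ n → ω i 1 = H → ω i 0 ≤ xm) ∧ (∀ t, t ≤ n → ω t ≠ pt (xm - 3) H) ∧
    ((i₀ + 2 ≤ n ∧ ω (i₀ + 1) = pt xm (H - 1) ∧ ω (i₀ + 2) = pt (xm - 1) (H - 1)) ∨
      (2 ≤ i₀ ∧ ω (i₀ - 1) = pt xm (H - 1) ∧ ω (i₀ - 2) = pt (xm - 1) (H - 1)))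

/-- **Dichotomy**: every canonical rooted polygon with `n ≥ 5` is in the class X ∪ Y⋆ or in the leaf class (repackaging of
`stepTwo_classify_roof`). [cite: MadrasSlade1993, §3.2 (proof of Theorem 3.2.3)] -/
theorem isStepTwoRoof_or_isTopLeaf (hω : ω ∈ canonEnd n) (hn : 5 ≤ n) : IsStepTwoRoof n ω ∨ IsTopLeaf n ω := by
  obtain ⟨H, xm, i₀, fwd, hi₀, hi₀n, hv, hx2, hH1, hmaxH, hmaxX, hcase⟩ := stepTwo_classify_roof hω hn
  rcases hcase with hX | ⟨hX, hrest⟩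
  · exact Or.inl ⟨H, xm, i₀, hi₀n, hv, hx2, hmaxH, hmaxX, Or.inl hX⟩
  rcases hrest with ⟨-, hi₀3, p1, p2, p3, k, hk, hkn, hrun, hdown⟩ | ⟨-, hi₀3, p1, p2, p3, k, hk, hki, hrun, hdown⟩ |
      ⟨-, h2n, h1, h2⟩ | ⟨-, h2, h1, h2'⟩
  · exact Or.inl ⟨H, xm, i₀, hi₀n, hv, hx2, hmaxH, hmaxX, Or.inr (Or.inl ⟨hi₀3, p1, p2, p3, k, hk, hkn, hrun, hdown⟩)⟩
  · exact Or.inl ⟨H, xm, i₀, hi₀n, hv, hx2, hmaxH, hmaxX, Or.inr (Or.inr ⟨hi₀3, p1, p2, p3, k, hk, hki, hrun, hdown⟩)⟩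
  · exact Or.inr ⟨H, xm, i₀, hi₀n, hv, hx2, hmaxH, hmaxX, hX, Or.inl ⟨h2n, h1, h2⟩⟩
  · exact Or.inr ⟨H, xm, i₀, hi₀n, hv, hx2, hmaxH, hmaxX, hX, Or.inr ⟨h2, h1, h2'⟩⟩

/-- At a top corner entered from below-right in time (`ω (i₀+1) = (xm,H−1)`), the predecessor is the left neighbour `(xm−1,H)`
(right and up are excluded by extremality, down is the successor). [cite: EntingJensen2009, §7.4.2, Fig. 7.10 (brickwork form of the honeycomb lattice)] -/
theorem corner_pred_of_succ_down {xm H : ℤ} {i₀ : ℕ} (hω : ω ∈ endAt n (Pi.single 0 1 : Site 2)) (hx : 2 ≤ xm)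
    (hmaxH : ∀ i, i ≤ n → ω i 1 ≤ H) (hmaxX : ∀ i, i ≤ n → ω i 1 = H → ω i 0 ≤ xm) (hi₀n : i₀ + 1 ≤ n)
    (hv : ω i₀ = pt xm H) (hs : ω (i₀ + 1) = pt xm (H - 1)) : 1 ≤ i₀ ∧ ω (i₀ - 1) = pt (xm - 1) H := by
  obtain ⟨⟨h0, -, hbw, hinj⟩, hn'⟩ := mem_endAt_iff.1 hω
  have hne : i₀ ≠ 0 := by
    intro h; rw [h, h0] at hv; have := congrFun hv 0; simp at this; omega
  refine ⟨by omega, ?_⟩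
  have hadj : brickWallGraph.Adj (ω i₀) (ω (i₀ - 1)) := by
    have := hbw (i₀ - 1) (by omega); rw [show i₀ - 1 + 1 = i₀ by omega] at this; exact this.symm
  rw [hv] at hadj
  have hback : ω (i₀ - 1) ≠ ω (i₀ + 1) := by
    intro h; have := hinj (show i₀ - 1 ∈ {i | i ≤ n} by simp; omega) (show i₀ + 1 ∈ {i | i ≤ n} by simp; omega) h; omega
  have hHt := hmaxH (i₀ - 1) (by omega)
  have hXt := hmaxX (i₀ - 1) (by omega)
  rcases adj_cases hadj with ⟨hz0, hz1⟩ | ⟨hz0, hz1⟩ | hz0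
  · exfalso; simp only [pt_apply_zero, pt_apply_one] at hz0 hz1; have := hXt hz1; omega
  · rw [ys_site_eq_iff]; simp only [pt_apply_zero, pt_apply_one] at hz0 hz1 ⊢; omega
  · rcases vertical_cases hadj hz0 with ⟨hy, hp⟩ | ⟨hy, hp⟩
    · exfalso; simp only [pt_apply_one] at hy; omega
    · exfalso; apply hback; rw [hs, ys_site_eq_iff]; simp only [pt_apply_zero, pt_apply_one] at hz0 hy ⊢; omega

/-- Backward form of `corner_pred_of_succ_down`: with `ω (i₀−1) = (xm,H−1)` (`1 ≤ i₀`), `ω (i₀+1) = (xm−1,H)` and `i₀ + 1 ≤ n`.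
[cite: EntingJensen2009, §7.4.2, Fig. 7.10 (brickwork form of the honeycomb lattice)] -/
theorem corner_succ_of_pred_down {xm H : ℤ} {i₀ : ℕ} (hω : ω ∈ endAt n (Pi.single 0 1 : Site 2)) (hx : 2 ≤ xm)
    (hmaxH : ∀ i, i ≤ n → ω i 1 ≤ H) (hmaxX : ∀ i, i ≤ n → ω i 1 = H → ω i 0 ≤ xm) (hi₀ : 1 ≤ i₀) (hi₀n : i₀ ≤ n)
    (hv : ω i₀ = pt xm H) (hp : ω (i₀ - 1) = pt xm (H - 1)) : i₀ + 1 ≤ n ∧ ω (i₀ + 1) = pt (xm - 1) H := by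
  obtain ⟨⟨h0, -, hbw, hinj⟩, hn'⟩ := mem_endAt_iff.1 hω
  have hne : i₀ ≠ n := by
    intro h; rw [h, hn'] at hv; have := congrFun hv 0; simp at this; omega
  refine ⟨by omega, ?_⟩
  have hadj : brickWallGraph.Adj (ω i₀) (ω (i₀ + 1)) := hbw i₀ (by omega)
  rw [hv] at hadj
  have hback : ω (i₀ + 1) ≠ ω (i₀ - 1) := by
    intro h; have := hinj (show i₀ + 1 ∈ {i | i ≤ n} by simp; omega) (show i₀ - 1 ∈ {i | i ≤ n} by simp; omega) h; omega
  have hHt := hmaxH (i₀ + 1) (by omega)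
  have hXt := hmaxX (i₀ + 1) (by omega)
  rcases adj_cases hadj with ⟨hz0, hz1⟩ | ⟨hz0, hz1⟩ | hz0
  · exfalso; simp only [pt_apply_zero, pt_apply_one] at hz0 hz1; have := hXt hz1; omega
  · rw [ys_site_eq_iff]; simp only [pt_apply_zero, pt_apply_one] at hz0 hz1 ⊢; omega
  · rcases vertical_cases hadj hz0 with ⟨hy, hp'⟩ | ⟨hy, hp'⟩
    · exfalso; simp only [pt_apply_one] at hy; omega
    · exfalso; apply hback; rw [hp, ys_site_eq_iff]; simp only [pt_apply_zero, pt_apply_one] at hz0 hy ⊢; omega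

/-- **The class X ∪ Y⋆ contains the main class X ∪ Y1a of `HexSAWPolygonStepTwoMain`** (Y1a is the roof move with `k = 1` when the
polygon is not already of class X), so `card_filter_isStepTwoRoof_le` subsumes `card_filter_isStepTwoMain_le`.
[cite: MadrasSlade1993, §3.2 (proof of Theorem 3.2.3)] -/
theorem isStepTwoRoof_of_isStepTwoMain (hω : ω ∈ canonEnd n) (hn : 2 ≤ n) (hm : IsStepTwoMain n ω) : IsStepTwoRoof n ω := by
  obtain ⟨hE, -⟩ := mem_canonEnd.1 hω
  obtain ⟨⟨h0, -, hbw, hinj⟩, hn'⟩ := mem_endAt_iff.1 hE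
  obtain ⟨H, xm, i₀, hi₀n, hv, hx2, hmaxH, hmaxX, hcase⟩ := hm
  by_cases hX : ∃ t, t ≤ n ∧ ω t = pt (xm - 3) H
  · exact ⟨H, xm, i₀, hi₀n, hv, hx2, hmaxH, hmaxX, Or.inl hX⟩
  push Not at hX
  have hH1 : 1 ≤ H := by
    have h1 := apply_one_of_mem_canonEnd hω hn
    have := hmaxH 1 (by omega); rw [h1.2] at this; exact this
  rcases hcase with hX' | ⟨h3n, h1, h2, h3⟩ | ⟨h3, h1, h2, h3'⟩
  · obtain ⟨t, ht, hωt⟩ := hX'; exact absurd hωt (hX t ht)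
  · have hpar : (xm + H) % 2 = 1 := by
      have hvc := vertical_cases (hbw i₀ (by omega)) (by rw [hv, h1]; simp)
      rw [hv, h1] at hvc; simp only [pt_apply_zero, pt_apply_one] at hvc; omega
    obtain ⟨hi₀1, hp⟩ := corner_pred_of_succ_down hE hx2 hmaxH hmaxX (by omega) hv h1
    obtain ⟨hi₀2, hp2⟩ := top_corner_pred hω hi₀1 (by omega) hv hmaxH hp h1
    obtain ⟨hi₀3, hp3⟩ := notX_pred_fwd hE hpar hH1 hmaxH hi₀2 (by omega) hp2 hp hX
    refine ⟨H, xm, i₀, hi₀n, hv, hx2, hmaxH, hmaxX, Or.inr (Or.inl ⟨hi₀3, hp, hp2, hp3, 1, le_rfl, by omega, ?_, ?_⟩)⟩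
    · intro s hs1 hs2
      interval_cases s
      · rw [h1]; congr 1; ring
      · rw [h2]; congr 1; ring
    · rw [h3]; congr 1; ring
  · have hpar : (xm + H) % 2 = 1 := by
      have hvc := vertical_cases (hbw (i₀ - 1) (by omega)) (by rw [show i₀ - 1 + 1 = i₀ by omega, hv, h1]; simp)
      rw [show i₀ - 1 + 1 = i₀ by omega, hv, h1] at hvc; simp only [pt_apply_zero, pt_apply_one] at hvc; omega
    obtain ⟨hi₀1, hs⟩ := corner_succ_of_pred_down hE hx2 hmaxH hmaxX (by omega) (by omega) hv h1
    obtain ⟨hi₀2, hs2⟩ := top_corner_succ hω (by omega) hi₀1 hv hmaxH hs h1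
    obtain ⟨hi₀3, hs3⟩ := notX_succ_bwd hE hpar hH1 hmaxH hi₀2 hs2 hs hX
    refine ⟨H, xm, i₀, hi₀n, hv, hx2, hmaxH, hmaxX, Or.inr (Or.inr ⟨hi₀3, hs, hs2, hs3, 1, le_rfl, by omega, ?_, ?_⟩)⟩
    · intro s hs1 hs2'
      interval_cases s
      · rw [h1]; congr 1; ring
      · rw [h2]; congr 1; ring
    · rw [show i₀ - (2 * 1 + 1) = i₀ - 3 by omega, h3']; congr 1; ring

/-- Hence `#{main class} ≤ #{class X ∪ Y⋆}` on `canonEnd n`. [cite: MadrasSlade1993, §3.2 (proof of Theorem 3.2.3)] -/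
theorem card_filter_isStepTwoMain_le_card_filter_isStepTwoRoof [DecidablePred (IsStepTwoMain n)] [DecidablePred (IsStepTwoRoof n)]
    (hn : 2 ≤ n) : #((canonEnd n).filter (IsStepTwoMain n)) ≤ #((canonEnd n).filter (IsStepTwoRoof n)) :=
  Finset.card_le_card fun ω hω => by
    rw [Finset.mem_filter] at hω ⊢
    exact ⟨hω.1, isStepTwoRoof_of_isStepTwoMain hω.1 hn hω.2⟩

/-- The decoding datum of an image: a case-X surgery (window, orientation, old-corner facts) or a roof surgery (run length `k ≥ 1`,
window, orientation, the three top-row sites beyond the corner). [cite: MadrasSlade1993, §3.2 (proof of Theorem 3.2.3)] -/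
def RoofDatum (n : ℕ) (ω W : ℕ → Site 2) (H xm : ℤ) (j k : ℕ) (fwd : Bool) : Prop :=
  (SpliceAddOK n 2 2 ω j (tpath offX 4 xm H fwd) ∧ (∀ s, s ≤ 2 → ω (j + s) = tpath w6A 2 xm H fwd s) ∧
      (fwd = true → ω (j + 3) = pt xm H) ∧ (fwd = false → 1 ≤ j ∧ ω (j - 1) = pt xm H) ∧
      W = spliceAdd 2 2 ω (tpath offX 4 xm H fwd) j) ∨
    (1 ≤ k ∧ SpliceAddOK n 2 (2 * k) ω j (tpath (offYs k) (2 * k + 2) xm H fwd) ∧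
      (∀ s, s ≤ 2 * k → ω (j + s) = tpath wYs (2 * k) xm H fwd s) ∧
      (fwd = true → 3 ≤ j ∧ ω (j - 1) = pt (xm - 1) H ∧ ω (j - 2) = pt (xm - 2) H ∧ ω (j - 3) = pt (xm - 2) (H - 1)) ∧
      (fwd = false → ω (j + 2 * k + 1) = pt (xm - 1) H ∧ ω (j + 2 * k + 2) = pt (xm - 2) H ∧
        ω (j + 2 * k + 3) = pt (xm - 2) (H - 1)) ∧
      W = spliceAdd 2 (2 * k) ω (tpath (offYs k) (2 * k + 2) xm H fwd) j)

/-- **An image with its decoding datum** for every polygon of the class X ∪ Y⋆. [cite: MadrasSlade1993, §3.2 (proof of Theorem 3.2.3)] -/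
theorem exists_stepTwoRoof_image (hω : ω ∈ canonEnd n) (hn : 5 ≤ n) (hm : IsStepTwoRoof n ω) :
    ∃ W : ℕ → Site 2, W ∈ canonEnd (n + 2) ∧ ∃ (H xm : ℤ) (j k : ℕ) (fwd : Bool),
      (∀ i, i ≤ n → ω i 1 ≤ H) ∧ (∀ i, i ≤ n → ω i 1 = H → ω i 0 ≤ xm) ∧ RoofDatum n ω W H xm j k fwd := by
  obtain ⟨H, xm, i₀, hi₀n, hv, hx2, hmaxH, hmaxX, hcase⟩ := hm
  rcases hcase with hX | ⟨hi₀3, p1, p2, p3, k, hk, hkn, hrun, hdown⟩ | ⟨hi₀3, p1, p2, p3, k, hk, hki, hrun, hdown⟩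
  · obtain ⟨j, fwd, hP, hw, hvf, hvb⟩ := stepTwo_data_X hω hn hmaxH hmaxX ⟨i₀, by omega, hv⟩ hX
    exact ⟨_, spliceAdd_mem_canonEnd hω hP, H, xm, j, 0, fwd, hmaxH, hmaxX, Or.inl ⟨hP, hw, hvf, hvb, rfl⟩⟩
  · obtain ⟨hP, hw⟩ := stepTwo_data_Ys_fwd hω (by omega) hk hkn hmaxH hmaxX hv hrun hdown
    exact ⟨_, spliceAdd_mem_canonEnd hω hP, H, xm, i₀, k, true, hmaxH, hmaxX,
      Or.inr ⟨hk, hP, hw, fun _ => ⟨hi₀3, p1, p2, p3⟩, fun h => absurd h (by decide), rfl⟩⟩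
  · obtain ⟨hP, hw⟩ := stepTwo_data_Ys_bwd hω (by omega) hk hki (by omega) hmaxH hmaxX hv hrun hdown
    refine ⟨_, spliceAdd_mem_canonEnd hω hP, H, xm, i₀ - 2 * k, k, false, hmaxH, hmaxX,
      Or.inr ⟨hk, hP, hw, fun h => absurd h (by decide), fun _ => ⟨?_, ?_, ?_⟩, rfl⟩⟩
    · rw [show i₀ - 2 * k + 2 * k + 1 = i₀ + 1 by omega, p1]
    · rw [show i₀ - 2 * k + 2 * k + 2 = i₀ + 2 by omega, p2]
    · rw [show i₀ - 2 * k + 2 * k + 3 = i₀ + 3 by omega, p3]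

/-- **Decoding is datum-free**: two polygons of `canonEnd n` with images-with-datum that coincide are equal — X/X by `spliceX_decode`,
Y⋆/Y⋆ by `spliceYs_decode`, X/Y⋆ impossible by `spliceX_ne_spliceYs`.
[cite: MadrasSlade1993, §3.2 (proof of Theorem 3.2.3: "Q can be unambiguously determined")] -/
theorem eq_of_stepTwoRoof_image_eq {ω₁ ω₂ W : ℕ → Site 2} (hω₁ : ω₁ ∈ canonEnd n) (hω₂ : ω₂ ∈ canonEnd n)
    {H₁ xm₁ : ℤ} {j₁ k₁ : ℕ} {fwd₁ : Bool} {H₂ xm₂ : ℤ} {j₂ k₂ : ℕ} {fwd₂ : Bool}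
    (hmaxH₁ : ∀ i, i ≤ n → ω₁ i 1 ≤ H₁) (hmaxX₁ : ∀ i, i ≤ n → ω₁ i 1 = H₁ → ω₁ i 0 ≤ xm₁)
    (hmaxH₂ : ∀ i, i ≤ n → ω₂ i 1 ≤ H₂) (hmaxX₂ : ∀ i, i ≤ n → ω₂ i 1 = H₂ → ω₂ i 0 ≤ xm₂)
    (h₁ : RoofDatum n ω₁ W H₁ xm₁ j₁ k₁ fwd₁) (h₂ : RoofDatum n ω₂ W H₂ xm₂ j₂ k₂ fwd₂) : ω₁ = ω₂ := by
  rcases h₁ with ⟨hP₁, hw₁, hvf₁, hvb₁, rfl⟩ | ⟨hk₁, hP₁, hw₁, hpre₁, hpost₁, rfl⟩ <;>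
    rcases h₂ with ⟨hP₂, hw₂, hvf₂, hvb₂, h⟩ | ⟨hk₂, hP₂, hw₂, hpre₂, hpost₂, h⟩
  · exact spliceX_decode hω₁ hω₂ hmaxH₁ hmaxX₁ hmaxH₂ hmaxX₂ hP₁ hP₂ hw₁ hw₂ hvf₁ hvf₂ h
  · exact (spliceX_ne_spliceYs hω₁ hk₂ hmaxH₁ hmaxX₁ hmaxH₂ hmaxX₂ hP₁ hP₂ hvf₁ hvb₁ h).elim
  · exact (spliceX_ne_spliceYs hω₂ hk₁ hmaxH₂ hmaxX₂ hmaxH₁ hmaxX₁ hP₂ hP₁ hvf₂ hvb₂ h.symm).elim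
  · exact spliceYs_decode hω₁ hω₂ hk₁ hk₂ hmaxH₁ hmaxX₁ hmaxH₂ hmaxX₂ hP₁ hP₂ hw₁ hw₂ hpre₁ hpost₁ hpre₂ hpost₂ h

/-- **★ The step two holds on the class X ∪ Y⋆**: the canonical rooted `(n+1)`-gons (`n ≥ 5`) of class X ∪ Y⋆ inject into the canonical
rooted `(n+3)`-gons, so their number is at most `#canonEnd (n+2) = q_{n+3}(ℍ)`.  The complement is the leaf class (numerically ≈ 16 %
of `canonEnd n` for `13 ≤ n ≤ 29`), against ≈ 30 % for the residue of `card_filter_isStepTwoMain_le`.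
[cite: MadrasSlade1993, §3.2, Theorem 3.2.3 / (3.2.3) (the `ℤ^d` statement being transplanted)] -/
theorem card_filter_isStepTwoRoof_le [DecidablePred (IsStepTwoRoof n)] (hn : 5 ≤ n) :
    #((canonEnd n).filter (IsStepTwoRoof n)) ≤ #(canonEnd (n + 2)) := by
  classical
  let E : (ℕ → Site 2) → (ℕ → Site 2) := fun ω =>
    if h : ω ∈ canonEnd n ∧ IsStepTwoRoof n ω then Classical.choose (exists_stepTwoRoof_image h.1 hn h.2) else ω
  have hE : ∀ ω, ∀ h : ω ∈ canonEnd n ∧ IsStepTwoRoof n ω,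
      E ω = Classical.choose (exists_stepTwoRoof_image h.1 hn h.2) := fun ω h => dif_pos h
  refine Finset.card_le_card_of_injOn E (fun ω hω => ?_) (fun ω₁ hω₁ ω₂ hω₂ heq => ?_)
  · rw [Finset.mem_coe, Finset.mem_filter] at hω
    rw [Finset.mem_coe, hE ω hω]
    exact (Classical.choose_spec (exists_stepTwoRoof_image hω.1 hn hω.2)).1
  · rw [Finset.mem_coe, Finset.mem_filter] at hω₁ hω₂
    rw [hE ω₁ hω₁, hE ω₂ hω₂] at heq
    obtain ⟨-, H₁, xm₁, j₁, k₁, fwd₁, hmaxH₁, hmaxX₁, h₁⟩ := Classical.choose_spec (exists_stepTwoRoof_image hω₁.1 hn hω₁.2)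
    obtain ⟨-, H₂, xm₂, j₂, k₂, fwd₂, hmaxH₂, hmaxX₂, h₂⟩ := Classical.choose_spec (exists_stepTwoRoof_image hω₂.1 hn hω₂.2)
    rw [heq] at h₁
    exact eq_of_stepTwoRoof_image_eq hω₁.1 hω₂.1 hmaxH₁ hmaxX₁ hmaxH₂ hmaxX₂ h₁ h₂

/-- **Complement form**: `#canonEnd n − #(leaf class) ≤ #canonEnd (n+2)` — the step two `q_{n+1}(ℍ) ≤ q_{n+3}(ℍ)` would follow from an
injection of the leaf class into the images NOT used by the class X ∪ Y⋆. [cite: MadrasSlade1993, §3.2, Theorem 3.2.3 / (3.2.3)] -/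
theorem card_canonEnd_sub_card_filter_topLeaf_le [DecidablePred (IsStepTwoRoof n)] [DecidablePred (IsTopLeaf n)] (hn : 5 ≤ n) :
    #(canonEnd n) - #((canonEnd n).filter (IsTopLeaf n)) ≤ #(canonEnd (n + 2)) := by
  classical
  have hcover : canonEnd n ⊆ (canonEnd n).filter (IsStepTwoRoof n) ∪ (canonEnd n).filter (IsTopLeaf n) := by
    intro ω hω
    rcases isStepTwoRoof_or_isTopLeaf hω hn with h | h
    · exact Finset.mem_union_left _ (Finset.mem_filter.2 ⟨hω, h⟩)
    · exact Finset.mem_union_right _ (Finset.mem_filter.2 ⟨hω, h⟩)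
  have h1 := (Finset.card_le_card hcover).trans (Finset.card_union_le _ _)
  have h2 := card_filter_isStepTwoRoof_le (n := n) hn
  omega

/-- **The leaf class in the printed normalisation**: `q_{n+1}(ℍ) − #{ω ∈ canonEnd n | IsTopLeaf n ω} ≤ q_{n+3}(ℍ)` for `n ≥ 5`
(`#canonEnd n = q_{n+1}(ℍ)`, `HexSAWPolygonSupermult.card_canonEnd`). [cite: MadrasSlade1993, §3.2, Theorem 3.2.3 / (3.2.3)] -/
theorem hexPolygonNumber_sub_card_topLeaf_le [DecidablePred (IsTopLeaf n)] (hn : 5 ≤ n) :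
    hexPolygonNumber (n + 1) - #((canonEnd n).filter (IsTopLeaf n)) ≤ hexPolygonNumber (n + 3) := by
  classical
  have h := card_canonEnd_sub_card_filter_topLeaf_le (n := n) hn
  rw [card_canonEnd (by omega), card_canonEnd (by omega)] at h
  exact h

end RoofMain

end PolygonConcat

end HexBW

end Literature.Probability.RandomPlanarGeometry.SAW

end
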